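import Literature.Geometry.Riemannian.ExpMapJacobiField
import Literature.Geometry.Riemannian.ExpMapEnergyTaylor
import Literature.Geometry.Riemannian.NormalExpGaussLemma
import Literature.Geometry.Lorentzian.CovariantDerivAlongLinear
import HarnessLib

/-!
# The Christoffel symbols of normal coordinates vanish at the centre (Lee 2018, Prop. 5.24 (d))

Topic `Geometry/Riemannian`. Invariant form of Lee 2018, Prop. 5.24 (d) ("the Christoffel
symbols in normal coordinates vanish at `p`"): for a geodesically complete, torsion-free, `C^∞`
covariant derivative `cov` on the tangent bundle of a Hausdorff manifold without boundary, a point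
`y` and tangent vectors `a, b ∈ T_yM`, the coordinate field `u ↦ d(exp_y)_{ua}(b)` along the
radial geodesic `u ↦ exp_y(ua)` — the field `∂_b` of the normal chart along the `a`-axis — has
vanishing covariant derivative at the centre:

* `covariantDerivAlong_mfderiv_expMap_zero` — **`D_u (d(exp_y)_{ua} b)|_{u=0} = 0`**, i.e.
  `∇_{∂_a} ∂_b (y) = 0`.

Proof (Lee, via Jacobi fields, Prop. 10.10): the variation field `J(u) = ∂_s|₀ exp_y(u(a + sb))`
of the geodesic variation is `J(u) = d(exp_y)_{ua}(ub) = u T(u)` with `T(u) = d(exp_y)_{ua}(b)`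
(`velocity_expVariation_eq_mfderiv_expMap`), it satisfies the Jacobi equation
`D_u D_u J + R(J, γ') γ' = 0` (`jacobi_expVariation`) with `J(0) = 0`, so `D_u D_u J(0) = 0`; and by
the Leibniz rule `D_u J = T + u D_u T`, `D_u D_u J(0) = 2 D_u T(0)`.

This is the input "`∇_{∂ᵢ} ∂ⱼ = 0` at the core" for the first-order structure of the metric in Fermi
coordinates along a curve (Weinstein 1968, proof of the main theorem, step (2): the tube around
the dense arc), where the normal slices of the tube map are normal charts of the fibres.

## References

* J. M. Lee, *Introduction to Riemannian Manifolds*, 2nd ed., Springer GTM 176 (2018),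
  Prop. 5.24 (d), Prop. 10.10. [cite: LeeRiemannianManifolds2018, Prop. 5.24]
* A. Weinstein, Ann. of Math. (2) 87 (1968), 29–41. [cite: Weinstein1968]

Tags: [NormalCoordinates] [ChristoffelSymbols] [JacobiField] [Weinstein1968]
-/

noncomputable section

open Bundle Set Filter Function
open scoped Manifold ContDiff Topology

namespace Literature.Geometry.Riemannian

open Literature.Geometry.Lorentzian

variable {E : Type*} [NormedAddCommGroup E] [NormedSpace ℝ E] {H : Type*} [TopologicalSpace H]
  {I : ModelWithCorners ℝ E H} {M : Type*} [TopologicalSpace M] [ChartedSpace H M]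
  [IsManifold I ∞ M] [FiniteDimensional ℝ E] [CompleteSpace E] [T2Space M]
  [BoundarylessManifold I M]
  {cov : CovariantDerivative I E (TangentSpace I : M → Type _)}
  [CovariantDerivative.ContMDiffCovariantDerivative cov 1]
  [CovariantDerivative.ContMDiffCovariantDerivative cov ∞]

omit [FiniteDimensional ℝ E] [CompleteSpace E] [T2Space M] [BoundarylessManifold I M]
  [CovariantDerivative.ContMDiffCovariantDerivative cov 1]
  [CovariantDerivative.ContMDiffCovariantDerivative cov ∞] [IsManifold I ∞ M] in
/-- Equality of points of `TM` from equality of base points and of the vectors read in `E`.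
[folklore] -/
private theorem totalSpace_mk_eq {p p' : M} (hp : p = p') {v : TangentSpace I p}
    {v' : TangentSpace I p'} (hv : (v : E) = v') :
    (TotalSpace.mk' E p v : TangentBundle I M) = TotalSpace.mk' E p' v' := by
  subst hp
  have hv' : v = v' := hv
  rw [hv']

/-- **The Christoffel symbols of normal coordinates vanish at the centre** (Lee 2018,
Prop. 5.24 (d)), invariantly: for a geodesically complete torsion-free `C^∞` covariant derivative,
`y ∈ M` and `a, b ∈ T_yM`, the field `u ↦ d(exp_y)_{ua}(b)` along the radial geodesic
`u ↦ exp_y(ua)` has zero covariant derivative at `u = 0`. Via the Jacobi field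
`J(u) = d(exp_y)_{ua}(ub) = u · d(exp_y)_{ua}(b)` of the geodesic variation `exp_y(u(a + sb))`
(`velocity_expVariation_eq_mfderiv_expMap`, `jacobi_expVariation`: `D_u D_u J(0) = -R(J(0), ·)· = 0`)
and the Leibniz rule (`D_u D_u (uT) (0) = 2 D_u T(0)`).
[cite: LeeRiemannianManifolds2018, Prop. 5.24 (d)] -/
theorem covariantDerivAlong_mfderiv_expMap_zero
    (hcov₁ : cov.IsLocallyContMDiff 1) (hcov : cov.IsLocallyContMDiff ∞) (htors : cov.torsion = 0)
    (hc : IsGeodesicallyComplete cov) (y : M) (a b : TangentSpace I y) :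
    covariantDerivAlong cov (fun u : ℝ ↦ expMap cov y (u • a))
      (fun u : ℝ ↦ mfderiv 𝓘(ℝ, E) I (fun z : E ↦ expMap cov y (show TangentSpace I y from z))
        (u • (show E from a)) (show E from b)) 0 = 0 := by
  set f : E → M := fun z : E ↦ expMap cov y (show TangentSpace I y from z) with hf
  have hfs : ContMDiff 𝓘(ℝ, E) I ∞ f :=
    contMDiff_expMap_of_isGeodesicallyComplete (cov := cov) (k := (⊤ : ℕ∞)) le_top hc y
  have hfd : ∀ z : E, MDifferentiableAt 𝓘(ℝ, E) I f z := fun z ↦ (hfs z).mdifferentiableAt (by simp)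
  -- the radial geodesic, in the syntactic form of the Jacobi identity of the tree
  set γ₀ : ℝ → M := fun t ↦ expMap cov y (t • (a + (0 : ℝ) • b)) with hγ₀
  have hγ : γ₀ = fun u : ℝ ↦ expMap cov y (u • a) := by
    funext t
    simp only [hγ₀, zero_smul, add_zero]
  set T : Π u : ℝ, TangentSpace I (γ₀ u) :=
    fun u ↦ mfderiv 𝓘(ℝ, E) I f (u • (show E from a)) (show E from b) with hT
  /- (1) the Jacobi identity at `(s, t₀) = (0, 0)`; the curvature term vanishes since `J(0) = 0` -/
  have hJac := jacobi_expVariation (cov := cov) hcov₁ htors hc y a b 0 0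
  rw [velocity_expVariation_zero y a b 0, map_zero, zero_apply, zero_apply, add_zero] at hJac
  /- (2) the smooth lift of `T` along `γ₀`, through the two-parameter map `(t, u) ↦ f(ua + tb)` -/
  have hx' : ContMDiff (𝓘(ℝ, ℝ).prod 𝓘(ℝ, ℝ)) I ∞
      (uncurry fun t u : ℝ ↦ f (u • (show E from a) + t • (show E from b))) := by
    have hA : ContMDiff (𝓘(ℝ, ℝ).prod 𝓘(ℝ, ℝ)) 𝓘(ℝ, E) ∞
        (fun q : ℝ × ℝ ↦ q.2 • (show E from a) + q.1 • (show E from b)) :=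
      (contMDiff_snd.smul contMDiff_const).add (contMDiff_fst.smul contMDiff_const)
    exact hfs.comp hA
  have hL := contMDiff_lift_velocity_uncurry_left hx'
  have hline : ContMDiff 𝓘(ℝ, ℝ) (𝓘(ℝ, ℝ).prod 𝓘(ℝ, ℝ)) ∞ (fun u : ℝ ↦ (((0 : ℝ), u) : ℝ × ℝ)) :=
    contMDiff_const.prodMk contMDiff_id
  have hL' := hL.comp hline
  have hfunL : ((fun q : ℝ × ℝ ↦ (TotalSpace.mk' E (f (q.2 • (show E from a) + q.1 • (show E from b)))
      (velocity I (fun t ↦ f (q.2 • (show E from a) + t • (show E from b))) q.1) :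
        TangentBundle I M)) ∘ fun u : ℝ ↦ (((0 : ℝ), u) : ℝ × ℝ)) =
      fun u ↦ (TotalSpace.mk' E (γ₀ u) (T u) : TangentBundle I M) := by
    funext u
    simp only [comp_apply]
    refine totalSpace_mk_eq ?_ ?_
    · simp only [hγ₀, hf, zero_smul, add_zero]
      rfl
    · exact velocity_comp_lineAt_zero (hfd _) _
  rw [hfunL] at hL'
  have hTd : ∀ t, MDifferentiableAt 𝓘(ℝ, ℝ) I.tangent
      (fun u ↦ (TotalSpace.mk' E (γ₀ u) (T u) : TangentBundle I M)) t :=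
    fun t ↦ (hL' t).mdifferentiableAt (by simp)
  /- (3) `J(u) = u • T(u)` -/
  have hJT : (fun t : ℝ ↦ velocity I (fun s' : ℝ ↦ expMap cov y (t • (a + s' • b))) 0) =
      fun t : ℝ ↦ t • T t := by
    funext t
    rw [velocity_expVariation_eq_mfderiv_expMap hc y a b t]
    exact (mfderiv 𝓘(ℝ, E) I f (t • (show E from a))).map_smul t (show E from b)
  /- (4) Leibniz: `D_u J = T + u • D_u T` along `γ₀` -/
  set S : Π t : ℝ, TangentSpace I (γ₀ t) := fun t ↦ covariantDerivAlong cov γ₀ T t with hS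
  have hDJ : (fun t ↦ covariantDerivAlong cov γ₀
      (fun t : ℝ ↦ velocity I (fun s' : ℝ ↦ expMap cov y (t • (a + s' • b))) 0) t) =
      fun t ↦ T t + t • S t := by
    funext t
    rw [hJT]
    have h := covariantDerivAlong_smul_holds (cov := cov) (γ := γ₀) (W := T) (f := fun t : ℝ ↦ t)
      (t₀ := t) differentiableAt_id (hTd t)
    rw [h]
    simp only [deriv_id'', one_smul]
    rfl
  /- (5) the lift of `S = D_u T` is smooth, hence `u • S` has a differentiable lift -/
  have hSl := contMDiff_lift_covariantDerivAlong_of_lift (cov := cov) hcov hL'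
  have hSd : MDifferentiableAt 𝓘(ℝ, ℝ) I.tangent
      (fun u ↦ (TotalSpace.mk' E (γ₀ u) (S u) : TangentBundle I M)) 0 :=
    (hSl 0).mdifferentiableAt (by simp)
  have huS : MDifferentiableAt 𝓘(ℝ, ℝ) I.tangent
      (fun u ↦ (TotalSpace.mk' E (γ₀ u) (u • S u) : TangentBundle I M)) 0 := by
    have h1 := contMDiffAt_totalSpaceMk_smul (I := I) (c := γ₀) (V := S) (s₀ := 0) (hSl 0) 0
    have h2 : ContMDiffAt 𝓘(ℝ, ℝ) (𝓘(ℝ, ℝ).prod 𝓘(ℝ, ℝ)) ∞ (fun u : ℝ ↦ ((u, u) : ℝ × ℝ)) 0 :=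
      contMDiffAt_id.prodMk contMDiffAt_id
    exact (ContMDiffAt.comp (I' := 𝓘(ℝ, ℝ).prod 𝓘(ℝ, ℝ)) (f := fun u : ℝ ↦ ((u, u) : ℝ × ℝ)) 0
      h1 h2).mdifferentiableAt (by simp)
  /- (6) `D_u D_u J(0) = S 0 + S 0` -/
  rw [hDJ] at hJac
  have hadd := covariantDerivAlong_add_holds (cov := cov) (γ := γ₀) (W₁ := T)
    (W₂ := fun u ↦ u • S u) (t₀ := 0) (hTd 0) huS
  have hsmul := covariantDerivAlong_smul_holds (cov := cov) (γ := γ₀) (W := S)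
    (f := fun t : ℝ ↦ t) (t₀ := 0) differentiableAt_id hSd
  simp only [deriv_id'', one_smul, zero_smul, add_zero] at hsmul
  have key : covariantDerivAlong cov γ₀ (fun t ↦ T t + t • S t) 0 = S 0 + S 0 := by
    rw [hadd, hsmul]
  rw [key] at hJac
  have hS0 : S 0 = 0 := by
    have h2 : (2 : ℝ) • S 0 = 0 := by rw [two_smul]; exact hJac
    rcases smul_eq_zero.1 h2 with h | h
    · exact absurd h two_ne_zero
    · exact h
  /- (7) transport from `γ₀` to the radial geodesic `u ↦ exp_y(ua)` -/
  have hS0' : covariantDerivAlong cov γ₀ T 0 = 0 := hS0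
  rw [hγ] at hS0'
  exact hS0'

end Literature.Geometry.Riemannian

end
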